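/-
Copyright (c) 2026. All rights reserved.
Released under Apache 2.0 license as described in the file LICENSE.
-/
import Literature.AlgebraicGeometry.Pohlmann1968.MultiquadraticCMFieldDegreeSixteenAllPowersHodgeConjecture
import HarnessLib

/-!
# The Hodge conjecture for every power of every abelian variety with complex multiplication by a MULTIQUADRATIC CM
# field of degree `≤ 16` — `K = ℚ(√−d)`, `ℚ(√−d, √a)`, `ℚ(√−d, √a, √b)`, `ℚ(√−d, √a, √b, √c)` — unconditionally,
# with `Bᵐ(Aⁿ) ⊗ ℂ = Dᵐ(Aⁿ) ⊗ ℂ`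

The umbrella over the tree's degree slices: `[K:ℚ] ≤ 6` (`CMFieldDegreeLeSixAllPowersHodgeConjecture`: any CM type of a
CM field of degree `≤ 6`), `[K:ℚ] = 8` Galois (`GaloisOcticCMFieldAllPowersHodgeConjecture`, seat p10 g37-#8) and
`[K:ℚ] = 16` multiquadratic (`MultiquadraticCMFieldDegreeSixteenAllPowersHodgeConjecture`, g37-#12).  A Galois group of
exponent `2` is a `2`-group, so `[K:ℚ] = |Gal(K/ℚ)| ∈ {1, 2, 4, 8, 16}` when `[K:ℚ] ≤ 16`.

* **`hodgeClassSpan_pow_eq_divisorClassesSpan_of_sq_eq_one_of_finrank_le_sixteen`** — `K` a CM field Galois over `ℚ`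
  with `g² = 1` for all `g ∈ Gal(K/ℚ)` and `[K:ℚ] ≤ 16`, `Φ` ANY CM type, `(A, ι, θ)` ANY realisation:
  `Bᵐ(Aⁿ) ⊗ ℂ = Dᵐ(Aⁿ) ⊗ ℂ` for all `n, m`; **`hodgeConjectureFor_pow_of_sq_eq_one_of_finrank_le_sixteen`** — the Hodge
  conjecture for `Aⁿ`, every `n`; `hodgeClasses_algebraic_pow_of_sq_eq_one_of_finrank_le_sixteen`;
  `finrank_mem_of_sq_eq_one_of_finrank_le_sixteen` (`[K:ℚ] ∈ {1, 2, 4, 8, 16}`).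

HONEST SCOPE.  Multiquadratic CM fields of degree `32` and beyond are not treated (rank-`9` types on `(ℤ/2)⁵` need not
be induced).  THEOREMS ONLY: no definition, no named fact, no instance, no `sorry`.  T. Kubota [Kubota1965] §4 Lemma 2;
B. B. Gordon [Gordon1999HodgeAVSurvey] Thm. 6.4, §9.3; B. Dodson [Dodson1984] §3.1.1, §3.3.2; B. Moonen, Yu. Zarhin
[MoonenZarhin1999LowDim] Thm. 0.1.

## Provenance

Lane `lit-hodgefound` (Track 2, Layer A5), seat `lit-hodgefound-p10` generation 37, row g37-#13; neighbours cited by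
name, nothing restated: `CMFieldDegreeLeSixAllPowersHodgeConjecture` (`hodgeClassSpan_pow_eq_divisorClassesSpan_of_finrank_le_six`),
`GaloisOcticCMFieldAllPowersHodgeConjecture` (`hodgeClassSpan_pow_eq_divisorClassesSpan_of_isGalois_eight`),
`MultiquadraticCMFieldDegreeSixteenAllPowersHodgeConjecture` (`Multiquadratic.hodgeClassSpan_pow_eq_divisorClassesSpan_of_finrank_eq_sixteen`),
Mathlib `IsPGroup.iff_card`, `IsGalois.card_aut_eq_finrank`.
-/

open scoped Classical NumberField
open NumberField Module CategoryTheory CategoryTheory.Limits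

namespace Literature.AlgebraicGeometry.Pohlmann1968

namespace Multiquadratic

open Literature.AlgebraicGeometry.Motives (CMType AbelianVariety)
open Literature.AlgebraicGeometry.HodgeTheory
open Literature.AlgebraicGeometry.VanGeemen1994 (hodgeClassSpan)
open Literature.Barriers.HodgeConjecture (divisorClassesSpan)
open Literature.AlgebraicGeometry.ComplexMultiplication (IsCMTypeRealisation)

variable {K : Type} [Field K] [NumberField K] [IsCMField K] [IsGalois ℚ K]
  {A : AbelianVariety ℂ} {ι : 𝓞 K →+* End A} {θ : K →+* Module.End ℂ (complexBetti A.X 1)}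

omit [IsCMField K] in
/-- **A Galois extension of `ℚ` with `Gal` of exponent `2` and degree `≤ 16` has degree `1, 2, 4, 8` or `16`** (`Gal` is
a `2`-group, `[K:ℚ] = |Gal|`; Milne: `|Aut(E/F)| = [E:F]` for `E/F` Galois, and a group of exponent `p` is a `p`-group).
[cite: MilneFT2022, Thm. 3.16] -/
theorem finrank_mem_of_sq_eq_one_of_finrank_le_sixteen (hexp : ∀ g : K ≃ₐ[ℚ] K, g ^ 2 = 1) (hK : finrank ℚ K ≤ 16) :
    finrank ℚ K = 1 ∨ finrank ℚ K = 2 ∨ finrank ℚ K = 4 ∨ finrank ℚ K = 8 ∨ finrank ℚ K = 16 := by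
  haveI : Fact (Nat.Prime 2) := ⟨Nat.prime_two⟩
  have hP : IsPGroup 2 (K ≃ₐ[ℚ] K) := fun g => ⟨1, by rw [pow_one]; exact hexp g⟩
  obtain ⟨n, hn⟩ := IsPGroup.iff_card.1 hP
  rw [IsGalois.card_aut_eq_finrank] at hn
  rw [hn] at hK ⊢
  have hn4 : n ≤ 4 := by
    by_contra hlt
    have h5 : 5 ≤ n := by omega
    have : 2 ^ 5 ≤ 2 ^ n := Nat.pow_le_pow_right (by norm_num) h5
    omega
  interval_cases n <;> simp

/-- **`Bᵐ(Aⁿ) ⊗ ℂ = Dᵐ(Aⁿ) ⊗ ℂ` FOR ALL `n, m`, FOR EVERY ABELIAN VARIETY WITH COMPLEX MULTIPLICATION BY A MULTIQUADRATIC CM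
FIELD OF DEGREE `≤ 16`** (any CM type, any realisation). [cite: Gordon1999HodgeAVSurvey, Thm. 6.4 and §9.3]
[cite: Kubota1965, §4 Lemma 2] [cite: Dodson1984, §3.3.2 Theorem] [cite: MoonenZarhin1999LowDim, Thm. 0.1] -/
theorem hodgeClassSpan_pow_eq_divisorClassesSpan_of_sq_eq_one_of_finrank_le_sixteen
    (hexp : ∀ g : K ≃ₐ[ℚ] K, g ^ 2 = 1) (hK : finrank ℚ K ≤ 16) (Φ : CMType K) (hA : IsCMTypeRealisation Φ A ι θ)
    (n m : ℕ) :
    hodgeClassSpan (⨁ fun _ : Fin n => A).dim (⨁ fun _ : Fin n => A).X m =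
      divisorClassesSpan (⨁ fun _ : Fin n => A).X (⨁ fun _ : Fin n => A).dim m := by
  rcases finrank_mem_of_sq_eq_one_of_finrank_le_sixteen hexp hK with h | h | h | h | h
  · exact hodgeClassSpan_pow_eq_divisorClassesSpan_of_finrank_le_six (by omega) Φ hA n m
  · exact hodgeClassSpan_pow_eq_divisorClassesSpan_of_finrank_le_six (by omega) Φ hA n m
  · exact hodgeClassSpan_pow_eq_divisorClassesSpan_of_finrank_le_six (by omega) Φ hA n m
  · exact hodgeClassSpan_pow_eq_divisorClassesSpan_of_isGalois_eight h Φ hA n m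
  · exact hodgeClassSpan_pow_eq_divisorClassesSpan_of_finrank_eq_sixteen hexp h Φ hA n m

omit [IsCMField K] [IsGalois ℚ K] in
/-- `Bᵐ ⊗ ℂ = Dᵐ ⊗ ℂ` for all `m` on an abelian variety gives the Hodge conjecture for it (Lefschetz `(1,1)` and cup
products, tree theorems). [cite: Gordon1999HodgeAVSurvey, §9.3] -/
private theorem hodgeConjectureFor_of_forall_hodgeClassSpan_eq₁₃ (B : AbelianVariety ℂ)
    (h : ∀ m : ℕ, hodgeClassSpan B.dim B.X m = divisorClassesSpan B.X B.dim m) : HodgeConjectureFor B.dim B.X :=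
  ⟨nonempty_hodgeModel_holds (Motives.AbelianVariety.isSmoothProjective_holds (A := B)),
    fun m _ hc hmm => AbelianVariety.divisorClassesSpan_le_algebraicClasses B
      (fun b hb hb' => lefschetzOneOne_rational_holds (Motives.AbelianVariety.isSmoothProjective_holds (A := B)) b hb hb')
      m ((h m) ▸ Submodule.subset_span ⟨hc, hmm⟩)⟩

/-- **THE HODGE CONJECTURE FOR EVERY POWER OF EVERY ABELIAN VARIETY WITH COMPLEX MULTIPLICATION BY A MULTIQUADRATIC CM
FIELD OF DEGREE `≤ 16`, UNCONDITIONALLY**: `K` a CM field Galois over `ℚ` with `Gal(K/ℚ)` of exponent `2` and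
`[K:ℚ] ≤ 16`, `Φ` ANY CM type, `(A, ι, θ)` ANY abelian variety of type `(K; Φ)` read on `H¹`: `HodgeConjectureFor` holds
for `Aⁿ = ⨁_{i<n} A`, every `n`. [cite: Gordon1999HodgeAVSurvey, Thm. 6.4 and §9.3] [cite: Kubota1965, §4 Lemma 2]
[cite: Dodson1984, §3.3.2 Theorem] [cite: MoonenZarhin1999LowDim, Thm. 0.1] -/
theorem hodgeConjectureFor_pow_of_sq_eq_one_of_finrank_le_sixteen (hexp : ∀ g : K ≃ₐ[ℚ] K, g ^ 2 = 1)
    (hK : finrank ℚ K ≤ 16) (Φ : CMType K) (hA : IsCMTypeRealisation Φ A ι θ) (n : ℕ) :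
    HodgeConjectureFor (⨁ fun _ : Fin n => A).dim (⨁ fun _ : Fin n => A).X :=
  hodgeConjectureFor_of_forall_hodgeClassSpan_eq₁₃ _
    (fun m => hodgeClassSpan_pow_eq_divisorClassesSpan_of_sq_eq_one_of_finrank_le_sixteen hexp hK Φ hA n m)

/-- **Every Hodge class on every power of an abelian variety with CM by a multiquadratic CM field of degree `≤ 16` is
algebraic.** [cite: Gordon1999HodgeAVSurvey, Thm. 6.4 and §9.3] -/
theorem hodgeClasses_algebraic_pow_of_sq_eq_one_of_finrank_le_sixteen (hexp : ∀ g : K ≃ₐ[ℚ] K, g ^ 2 = 1)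
    (hK : finrank ℚ K ≤ 16) (Φ : CMType K) (hA : IsCMTypeRealisation Φ A ι θ) (n m : ℕ)
    (c : complexBetti (⨁ fun _ : Fin n => A).X (2 * m)) (hcQ : IsRationalClass c)
    (hcH : IsOfHodgeType (⨁ fun _ : Fin n => A).dim (⨁ fun _ : Fin n => A).X (2 * m) m m c) :
    c ∈ algebraicClasses (⨁ fun _ : Fin n => A).X m :=
  (hodgeConjectureFor_pow_of_sq_eq_one_of_finrank_le_sixteen hexp hK Φ hA n).2 m c hcQ hcH

/-- **No power of an abelian variety with CM by a multiquadratic CM field of degree `≤ 16` carries an exceptional Hodge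
class.** [cite: Gordon1999HodgeAVSurvey, Thm. 6.4 and §9.3] -/
theorem not_exists_exceptional_pow_of_sq_eq_one_of_finrank_le_sixteen (hexp : ∀ g : K ≃ₐ[ℚ] K, g ^ 2 = 1)
    (hK : finrank ℚ K ≤ 16) (Φ : CMType K) (hA : IsCMTypeRealisation Φ A ι θ) (n m : ℕ) :
    ¬ ∃ c : complexBetti (⨁ fun _ : Fin n => A).X (2 * m), IsRationalClass c ∧
        IsOfHodgeType (⨁ fun _ : Fin n => A).dim (⨁ fun _ : Fin n => A).X (2 * m) m m c ∧
        c ∉ divisorClassesSpan (⨁ fun _ : Fin n => A).X (⨁ fun _ : Fin n => A).dim m := by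
  rintro ⟨c, hcQ, hcH, hcD⟩
  exact hcD ((hodgeClassSpan_pow_eq_divisorClassesSpan_of_sq_eq_one_of_finrank_le_sixteen hexp hK Φ hA n m) ▸
    Submodule.subset_span ⟨hcQ, hcH⟩)

end Multiquadratic

end Literature.AlgebraicGeometry.Pohlmann1968
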